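import Literature.Computability.Complexity.GateEliminationXorMap

/-!
# Gate elimination, XV: affine gates; a circuit computing a disperser has an ∧-type gate

Toolkit for the one-step claim `LiYang2022_step` (Li–Yang, STOC 2022; full version
ECCC TR21-023, §2.1 (the 16 binary functions: trivial, degenerate, ⊕-type, ∧-type) and §2.6
footnote 5: "If a circuit does not contain an ∧-type gate, it computes an affine function of
variables so that can be trivialized by a single affine substitution. Hence during the gate
elimination procedure, we may assume that there exists an ∧-type gate"). Everything is PROVED.

* `IsAffineOp`, `isAndOp_or_isAffineOp` (every binary Boolean function is ∧-type or affine),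
  `IsXorOp.isAffineOp`.
* `Consistent.xor3_of_affine`, `sol_xor3_of_affine`, `outFn`, `outFn_xor3_of_affine` — a fair
  semicircuit all of whose gates are affine computes a *xor-affine* function (`IsXorAffine`).
* `IsXorAffine.linearPart` (the functional `v ↦ g(v) + g(0)` on `𝔽₂ⁿ`), `IsXorAffine.apply_eq`;
  `exists_le_functional_const` (codimension-one constancy of a functional inside an affine
  subspace); **`IsAffineDisperser.not_xorAffine_on_sol`**: an affine disperser for dimension `d`
  agrees with no xor-affine function on an rdq-source of dimension `≥ 2d + 1` (via the canonical
  subspace of `GateEliminationSubst.lean`).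
* **`Semicircuit.exists_isAndOp`**: hence a fair semicircuit computing `f|_R` for such `f`, `R`
  has an ∧-type gate.

Not yet here: the relative version (an ancestor-closed ∧-free sub-circuit computes affine
functions at its gates), needed for topologically minimal ∧-gates and xor-reconstruction.

## References

* J. Li, T. Yang, *3.1n − o(n) circuit lower bounds for explicit functions*, STOC 2022
  [LiYang2022]; full version ECCC TR21-023, §2.1, §2.6.
-/

namespace Literature.Computability.Complexity

open Finset Module

/-! ### Affine binary functions -/

/-- A binary Boolean function is *affine*: `op a b = (a ∧ s₀) ⊕ (b ∧ s₁) ⊕ c` — the 8 functions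
that are not ∧-type (constants, projections and their negations, ⊕-type) (Li–Yang §2.1:
"trivial", "degenerate", "⊕-type"). [cite: LiYang2022, §2.1] -/
def IsAffineOp (op : Bool → Bool → Bool) : Prop :=
  ∃ s₀ s₁ c : Bool, ∀ a b : Bool, op a b = (((a && s₀) ^^ (b && s₁)) ^^ c)

/-- **Every binary Boolean function is ∧-type or affine** (8 + 8 = 16). [cite: LiYang2022, §2.1] -/
theorem isAndOp_or_isAffineOp (op : Bool → Bool → Bool) : IsAndOp op ∨ IsAffineOp op := by
  -- reduce to the truth table
  have key : ∀ v₀₀ v₀₁ v₁₀ v₁₁ : Bool,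
      (∃ c₁ c₂ c₃ : Bool, ∀ a b : Bool,
        (Bool.rec (Bool.rec v₀₀ v₀₁ b) (Bool.rec v₁₀ v₁₁ b) a : Bool) = (((a ^^ c₁) && (b ^^ c₂)) ^^ c₃)) ∨
      (∃ s₀ s₁ c : Bool, ∀ a b : Bool,
        (Bool.rec (Bool.rec v₀₀ v₀₁ b) (Bool.rec v₁₀ v₁₁ b) a : Bool) = (((a && s₀) ^^ (b && s₁)) ^^ c)) := by
    decide
  have hop : op = fun a b => (Bool.rec (Bool.rec (op false false) (op false true) b)
      (Bool.rec (op true false) (op true true) b) a : Bool) := by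
    funext a b; cases a <;> cases b <;> rfl
  rcases key (op false false) (op false true) (op true false) (op true true) with ⟨c₁, c₂, c₃, h⟩ | ⟨s₀, s₁, c, h⟩
  · left; refine ⟨c₁, c₂, c₃, fun a b => ?_⟩; rw [hop]; exact h a b
  · right; refine ⟨s₀, s₁, c, fun a b => ?_⟩; rw [hop]; exact h a b

/-- ⊕-type functions are affine. [folklore] -/
theorem IsXorOp.isAffineOp {op : Bool → Bool → Bool} (h : IsXorOp op) : IsAffineOp op := by
  obtain ⟨c, hc⟩ := h
  exact ⟨true, true, c, fun a b => by rw [hc]; cases a <;> cases b <;> cases c <;> rfl⟩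

namespace Semicircuit

variable {n : ℕ} (C : Semicircuit n)

/-! ### Circuits all of whose gates are affine compute affine functions -/

variable {C} in
/-- **If every gate is affine, the gate equations are affine**: the xor of three solutions on
three inputs is a solution on the xor of the inputs. [cite: LiYang2022, §2.6 (footnote 5)] -/
theorem Consistent.xor3_of_affine (haff : ∀ k, IsAffineOp (C.op k)) {x₁ x₂ x₃ : Fin n → Bool}
    {w₁ w₂ w₃ : Fin C.m → Bool} (h₁ : C.Consistent x₁ w₁) (h₂ : C.Consistent x₂ w₂) (h₃ : C.Consistent x₃ w₃) :
    C.Consistent (xor3 x₁ x₂ x₃) (xor3 w₁ w₂ w₃) := by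
  intro j
  obtain ⟨s₀, s₁, c, hc⟩ := haff j
  rw [nodeVal_xor3, nodeVal_xor3, hc]
  show ((w₁ j ^^ w₂ j) ^^ w₃ j) = _
  rw [h₁ j, h₂ j, h₃ j, hc, hc, hc]
  generalize C.nodeVal x₁ w₁ (C.arg j 0) = a₁
  generalize C.nodeVal x₂ w₂ (C.arg j 0) = a₂
  generalize C.nodeVal x₃ w₃ (C.arg j 0) = a₃
  generalize C.nodeVal x₁ w₁ (C.arg j 1) = b₁
  generalize C.nodeVal x₂ w₂ (C.arg j 1) = b₂
  generalize C.nodeVal x₃ w₃ (C.arg j 1) = b₃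
  cases a₁ <;> cases a₂ <;> cases a₃ <;> cases b₁ <;> cases b₂ <;> cases b₃ <;> cases s₀ <;> cases s₁ <;> cases c <;> rfl

/-- The solution map of a fair all-affine circuit is affine (everywhere). [cite: LiYang2022, §2.6] -/
theorem sol_xor3_of_affine (hF : C.Fair) (haff : ∀ k, IsAffineOp (C.op k)) (x₁ x₂ x₃ : Fin n → Bool) :
    C.sol hF (xor3 x₁ x₂ x₃) = xor3 (C.sol hF x₁) (C.sol hF x₂) (C.sol hF x₃) :=
  (((C.consistent_sol hF x₁).xor3_of_affine haff (C.consistent_sol hF x₂) (C.consistent_sol hF x₃)).eq_sol hF).symm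

/-- The output function `x ↦ value of the output node` of a fair semicircuit. [cite: LiYang2022, §2.5] -/
noncomputable def outFn (hF : C.Fair) (x : Fin n → Bool) : Bool := C.nodeVal x (C.sol hF x) C.out

/-- **A fair all-affine circuit computes an affine function**:
`out(x₁ ⊕ x₂ ⊕ x₃) = out x₁ ⊕ out x₂ ⊕ out x₃`. [cite: LiYang2022, §2.6 (footnote 5)] -/
theorem outFn_xor3_of_affine (hF : C.Fair) (haff : ∀ k, IsAffineOp (C.op k)) (x₁ x₂ x₃ : Fin n → Bool) :
    C.outFn hF (xor3 x₁ x₂ x₃) = ((C.outFn hF x₁ ^^ C.outFn hF x₂) ^^ C.outFn hF x₃) := by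
  unfold outFn
  rw [sol_xor3_of_affine C hF haff, nodeVal_xor3]

end Semicircuit

/-! ### Affine Boolean functions on `𝔽₂ⁿ` are constant on large affine subspaces -/

/-- A Boolean function on `Fin n → Bool` is *xor-affine*: `g(x₁ ⊕ x₂ ⊕ x₃) = g x₁ ⊕ g x₂ ⊕ g x₃`. [folklore] -/
def IsXorAffine {n : ℕ} (g : (Fin n → Bool) → Bool) : Prop :=
  ∀ x₁ x₂ x₃, g (Semicircuit.xor3 x₁ x₂ x₃) = ((g x₁ ^^ g x₂) ^^ g x₃)

/-- `Bool` read in `𝔽₂`: `false ↦ 0`, `true ↦ 1`. [folklore] -/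
def boolToZMod2 (b : Bool) : ZMod 2 := if b then 1 else 0

/-- `xor` becomes addition in `𝔽₂`. [folklore] -/
theorem boolToZMod2_xor (a b : Bool) : boolToZMod2 (a ^^ b) = boolToZMod2 a + boolToZMod2 b := by
  cases a <;> cases b <;> decide

/-- Back to `Bool` through `finTwoEquiv`. [folklore] -/
theorem finTwoEquiv_boolToZMod2 (b : Bool) : finTwoEquiv (boolToZMod2 b) = b := by
  cases b <;> decide

/-- `Bool ≃ ZMod 2`, addition read in `Bool`. [folklore] -/
theorem finTwoEquiv_add (a b : ZMod 2) : finTwoEquiv (a + b) = (finTwoEquiv a ^^ finTwoEquiv b) := by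
  revert a b; decide

/-- **The linear part of a xor-affine Boolean function**, as a linear functional on `𝔽₂ⁿ`:
`v ↦ g(v) + g(0)` (read in `𝔽₂`). [folklore] -/
noncomputable def IsXorAffine.linearPart {n : ℕ} {g : (Fin n → Bool) → Bool} (hg : IsXorAffine g) :
    (Fin n → ZMod 2) →ₗ[ZMod 2] ZMod 2 where
  toFun v := boolToZMod2 (g (boolOfZMod2.symm v) ^^ g (fun _ => false))
  map_add' u v := by
    have h := hg (boolOfZMod2.symm u) (boolOfZMod2.symm v) (fun _ => false)
    have hx : Semicircuit.xor3 (boolOfZMod2.symm u) (boolOfZMod2.symm v) (fun _ => false) =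
        boolOfZMod2.symm (u + v) := by
      funext i
      unfold Semicircuit.xor3
      rw [Circuit.boolOfZMod2_symm_apply, Circuit.boolOfZMod2_symm_apply, Circuit.boolOfZMod2_symm_apply,
        Pi.add_apply, finTwoEquiv_add, Bool.xor_false]
    rw [hx] at h
    rw [h, ← boolToZMod2_xor]
    congr 1
    generalize g (boolOfZMod2.symm u) = a
    generalize g (boolOfZMod2.symm v) = b
    generalize g (fun _ => false) = c
    cases a <;> cases b <;> cases c <;> rfl
  map_smul' r v := by
    have hr : r = 0 ∨ r = 1 := by revert r; decide
    rcases hr with rfl | rfl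
    · simp only [zero_smul, RingHom.id_apply]
      have : boolOfZMod2.symm (0 : Fin n → ZMod 2) = fun _ => false := by
        funext i; rw [Circuit.boolOfZMod2_symm_apply]; rfl
      rw [this, Bool.xor_self]; rfl
    · simp only [one_smul, RingHom.id_apply]

/-- The value of a xor-affine function from its linear part. [folklore] -/
theorem IsXorAffine.apply_eq {n : ℕ} {g : (Fin n → Bool) → Bool} (hg : IsXorAffine g) (v : Fin n → ZMod 2) :
    g (boolOfZMod2.symm v) = (finTwoEquiv (hg.linearPart v) ^^ g (fun _ => false)) := by
  show g (boolOfZMod2.symm v) = (finTwoEquiv (boolToZMod2 (g (boolOfZMod2.symm v) ^^ g (fun _ => false))) ^^ _)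
  rw [finTwoEquiv_boolToZMod2]
  cases g (boolOfZMod2.symm v) <;> cases g (fun _ => false) <;> rfl

/-- Inside a nonempty affine subspace and for a linear functional `φ`, there is a nonempty affine
subspace of codimension at most one on which `φ` is constant (generalizes
`exists_le_coord_const` from a coordinate to any functional). [folklore] -/
theorem exists_le_functional_const {K : Type*} [Field K] {V : Type*} [AddCommGroup V] [Module K V]
    [FiniteDimensional K V] (A : AffineSubspace K V) (hA : (A : Set V).Nonempty) (φ : V →ₗ[K] K) :
    ∃ A' : AffineSubspace K V, A' ≤ A ∧ (A' : Set V).Nonempty ∧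
      finrank K A.direction ≤ finrank K A'.direction + 1 ∧ ∀ u ∈ A', ∀ v ∈ A', φ u = φ v := by
  obtain ⟨p, hp⟩ := hA
  set E := A.direction with hE
  set f : E →ₗ[K] K := φ.comp E.subtype with hf
  set S : Submodule K V := (LinearMap.ker f).map E.subtype with hS
  refine ⟨AffineSubspace.mk' p S, ?_, ⟨p, AffineSubspace.self_mem_mk' p S⟩, ?_, ?_⟩
  · intro x hx
    have hx' : x -ᵥ p ∈ S := AffineSubspace.mem_mk'.mp hx
    have hxE : x -ᵥ p ∈ E := by
      obtain ⟨y, -, hy⟩ := Submodule.mem_map.mp hx'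
      rw [← hy]; exact y.2
    have := AffineSubspace.vadd_mem_of_mem_direction hxE hp
    rwa [vsub_vadd] at this
  · rw [AffineSubspace.direction_mk', hS, Submodule.finrank_map_subtype_eq]
    have h1 := LinearMap.finrank_range_add_finrank_ker f
    have h2 : finrank K (LinearMap.range f) ≤ 1 := by
      have := (LinearMap.range f).finrank_le
      rwa [Module.finrank_self] at this
    omega
  · have key : ∀ u ∈ AffineSubspace.mk' p S, φ u = φ p := by
      intro u hu
      have hu' : u -ᵥ p ∈ S := AffineSubspace.mem_mk'.mp hu
      obtain ⟨y, hy, hyu⟩ := Submodule.mem_map.mp hu'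
      have hy0 : f y = 0 := LinearMap.mem_ker.mp hy
      have : φ (u -ᵥ p) = 0 := by rw [← hyu]; simpa [hf] using hy0
      rw [vsub_eq_sub, map_sub, sub_eq_zero] at this
      exact this
    intro u hu v hv
    rw [key u hu, key v hv]

/-- **An affine disperser for dimension `d` does not agree with a xor-affine Boolean function on
an rdq-source of dimension `≥ 2d + 1`** (Li–Yang §2.6 footnote 5: "if a circuit does not contain
an ∧-type gate, it computes an affine function of variables so that can be trivialized by a
single affine substitution. Hence during the gate elimination procedure, we may assume that
there exists an ∧-type gate"). [cite: LiYang2022, §2.6] -/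
theorem IsAffineDisperser.not_xorAffine_on_sol {n d : ℕ} {f : (Fin n → ZMod 2) → Bool}
    (hf : IsAffineDisperser f d) (R : RdqSource n) (hd : 2 * d + 1 ≤ R.dim) {g : (Fin n → Bool) → Bool}
    (hg : IsXorAffine g) (hfg : ∀ v ∈ R.Sol, f v = g (boolOfZMod2.symm v)) : False := by
  obtain ⟨A, hA, hne, hdim, hq⟩ := R.exists_affineSubspace_subset_sol
  obtain ⟨A', hA', hne', hdim', hconst⟩ := exists_le_functional_const A hne hg.linearPart
  obtain ⟨u, hu, v, hv, huv⟩ := hf A' (by omega) hne'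
  apply huv
  rw [hfg u (hA (hA' hu)), hfg v (hA (hA' hv)), hg.apply_eq, hg.apply_eq, hconst u hu v hv]

namespace Semicircuit

variable {n : ℕ}

/-- **A fair semicircuit computing an affine disperser on a source of dimension `≥ 2d + 1` has an
∧-type gate.** [cite: LiYang2022, §2.6 (footnote 5)] -/
theorem exists_isAndOp {C : Semicircuit n} {f : (Fin n → ZMod 2) → Bool} {R : RdqSource n} {d : ℕ}
    (hf : IsAffineDisperser f d) (hd : 2 * d + 1 ≤ R.dim) (hF : C.Fair) (hC : C.ComputesRestr f R) :
    ∃ k, IsAndOp (C.op k) := by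
  by_contra hno
  push Not at hno
  have haff : ∀ k, IsAffineOp (C.op k) := fun k => (isAndOp_or_isAffineOp (C.op k)).resolve_left (hno k)
  refine hf.not_xorAffine_on_sol R hd (g := C.outFn hF) (fun x₁ x₂ x₃ => C.outFn_xor3_of_affine hF haff x₁ x₂ x₃)
    fun v hv => ?_
  exact (hC.2 v hv _ (C.consistent_sol hF _)).symm

end Semicircuit

end Literature.Computability.Complexity
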